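/-
Copyright (c) 2026 the pub-hodgecm-mathlib formalisation cell (harness21).  R90-TF SLAB, section S10 (Rogawski 1990, §13.8 Prop. 13.8.3 read at `v`),
prover K2E3-p12 (g11) — DEAL #98 (S10 dealer R90-C138-plan (g4), 2026-09-05T03:46:26Z): the local letter `hSat` HYPOTHESIS-FIRST; h413 = `stmt-HodgeConjecture-24833`,
route `HCCMUnconditional`.
-/
import Summits.HodgeConjecture.HodgeConjecture.Theorems.R90S10SphericalConstituentOfFrozen   -- ★ p865188 (K2Liu-p26): the `hSat` binder of record (:149–:154); brings ★ `S10HDatum`, ★ `cmPrincipalSeriesH`, ★ `unopSphericalCharacter`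
import HarnessLib

/-!
# R90-TF ∕ S10 — THE LOCAL LETTER «THE PARAMETER OF `ρ_w` IS A SATAKE PARAMETER OF `H_w`» (`SatakeParameterOfRhoLetter`), datum-free, and its bridge to ★ p865188's `hSat`
# (`Theorems/R90S10SatakeParameterOfRhoLetterDefs.lean`; ns `Summit.HodgeConjecture.HodgeConjecture.R90.S10`; ONE `def … : Prop` + `_iff` + ONE bridge theorem; no instance, no
# notation, no `sorry`; ★-only imports)

Print: [CartierCorvallis1979] §IV.1 Thm. 4.1 (Satake isomorphism `ℋ(G, K) ≅ ℂ[X_*(T)]^W` for `K` special), Cor. 4.1–4.2 (the `K`-spherical classes ↔ the characters of `ℋ(G, K)` ↔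
`W`-orbits of unramified characters; every character of `ℋ(G, K)` is the eigencharacter of the spherical line of an unramified principal series); [Rogawski1990] §12.1 pp. 171–172
(`i_H(χ)` for `H = U(2) × U(1)`), §12.2 pp. 173–174, §13.8 p. 218 L9 (ii), p. 219 L2–L3 («`ρ_w` unramified for all finite `w ≠ v`»).

WHY (DEAL #98 census `K2/K2E3-p12/g11/CENSUS-DEAL98-hSat.md` 24ef6446873a10c1): ★ p865188 pays (b2) of the keystone's `hPS♭` discharge modulo ONE local letter `hSat` «the
`ℋ(H_w, K_{H,w})`-character on `ρ_w`'s `K_H`-line is the spherical eigencharacter of SOME unramified `i_H(χ₂ ⊠ χ₁)`» — Satake surjectivity for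
`H_w = U(Φ₂)(L⁺_w) × U(Φ₁)(L⁺_w)`.  The tree HAS Cartier Cor. 4.2 for hyperspecial unitary groups in the `UnramifiedLocalConjDatum`∕`heckeEigencharacter` currency (★
`exists_eq_heckeEigencharacter_of_forall_mem`) but NOT the three bridges to this currency ((M1) spherical eigencharacter of ★ `cmPrincipalSeries` = `λ_χ`; (M2) the product group and
the `K_H`-line of ★ `cmPrincipalSeriesH`; (M3) the CM-carrier ↔ valued-field junction), so the letter is stated HYPOTHESIS-FIRST here, DATUM-FREE: for EVERY representation `π` of
`H_w` with a one-dimensional line of `K_H^{std} := U(Φ₂)(𝒪_w) × U(Φ₁)(𝒪_w)`-fixed vectors (no irreducibility needed — `ℋ(H_w, K_H^{std})` is commutative and acts on any such line by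
an algebra character), under ⟪U⟫ at `w` (`L∕L⁺` unramified above `w`, the regime of its consumer and of a future ★ payment), some `i_H(χ₂ ⊠ χ₁)` with `χ₁` smooth and a
`K_H^{std}`-line has the same character.  The bridge `S10HDatum.hSat_of_satakeParameterOfRhoLetter` rewrites the datum's levels off `v` to the standard ones (★ fields `hKH`,
`hK₂std`, `hK₁std`) and delivers ★ p865188's `hSat` binder VERBATIM.

HONEST LABEL: a `def … : Prop` and a bridge; the letter is a HYPOTHESIS (class (E1-c)-local, print-true [CartierCorvallis1979 §IV.1 Cor. 4.2]), not a proof; closes nothing; HC_CM is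
proved only modulo the 7 printed citations (2 remaining named inputs: hLiu418 = `stmt-HodgeConjecture-24832`, h413 = `stmt-HodgeConjecture-24833`) until rung 0 closes; REL ≠ ★ ≠ BUILT;
count-neutral.

## References
* [CartierCorvallis1979] P. Cartier, *Representations of 𝔭-adic groups: a survey*, Proc. Sympos. Pure Math. 33.1 (1979), §IV.1 Thm. 4.1, Cor. 4.1–4.2.
* [Rogawski1990] J. D. Rogawski, *Automorphic Representations of Unitary Groups in Three Variables*, Ann. of Math. Stud. 123 (1990), §12.1 pp. 171–172; §12.2 pp. 173–174;
  §13.8 p. 218 L9, p. 219 L2–L3.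
* [Satake1963] I. Satake, *Theory of spherical functions on reductive algebraic groups over 𝔭-adic fields*, Publ. Math. IHÉS 18 (1963), §6.
-/

set_option autoImplicit false
set_option linter.dupNamespace false

noncomputable section

open MeasureTheory MulAction NumberField IsDedekindDomain
open Literature.NumberTheory.Rogawski1990 Literature.NumberTheory.Automorphic Literature.NumberTheory.Automorphic.heckeAlgebra
open Literature.NumberTheory.Automorphic.UnitaryGroup Literature.NumberTheory.GaloisRepresentations
open Summit.HodgeConjecture.HodgeConjecture.Cruxes.H413.K2E1TraceFormulaBeta
open Summit.HodgeConjecture.HodgeConjecture.Cruxes.H413.K2E1SpectralTermsDiscreteHalf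
open Summit.HodgeConjecture.HodgeConjecture.Cruxes.H413.K2E1EigenvaluePackageOfSpherical
open Summit.HodgeConjecture.HodgeConjecture.Cruxes.H413.K2E1EvpOfAutomorphicClass

namespace Summit.HodgeConjecture.HodgeConjecture.R90.S10

/-! ## §1 The letter -/

/-- **THE LETTER «THE PARAMETER OF ANY `K_H^{std}`-LINE IS A SATAKE PARAMETER OF `H_w`»** (`SatakeParameterOfRhoLetter L w`).  At a finite place `w` of `L⁺` above which `L∕L⁺` is
UNRAMIFIED (⟪U⟫ at `w`): for every complex representation `π` of `H_w = U(Φ₂)(L⁺_w) × U(Φ₁)(L⁺_w)` whose space of vectors fixed by the standard level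
`K_H^{std} = U(Φ₂)(𝒪_w) × U(Φ₁)(𝒪_w)` (★ `cmLocalIntegralLevel`) is a LINE (the level enters as a parameter `K` pinned by `K = K_H^{std}`, so consumers instantiate without rewriting), there are a character `χ₂` of the diagonal torus of `U(Φ₂)_w` and a smooth character `χ₁` of `U(Φ₁)_w`
(`IsOpen χ₁.ker`) such that the unramified principal series `i_H(χ₂ ⊠ χ₁)` (★ `cmPrincipalSeriesH L w χ₂ χ₁`) has a `K_H^{std}`-line with THE SAME algebra character of
`ℋ(H_w, K_H^{std})` (★ `unopSphericalCharacter`) — «every character of `ℋ(G, K)` is `ev_χ ∘ 𝒮`» [Cor. 4.2] read back on the principal series.  Class (E1-c)-local; print-true;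
NOT ★ (bridges (M1)–(M3) of the census). [cite: CartierCorvallis1979, §IV.1 Thm. 4.1, Cor. 4.1–4.2] [cite: Rogawski1990, §12.1 pp. 171–172; §12.2 pp. 173–174] [cite: Satake1963, §6] -/
def SatakeParameterOfRhoLetter (L : Type) [Field L] [NumberField L] [IsCMField L] (w : Pl L) : Prop :=
  (∀ W : PlacesOver L w, Algebra.IsUnramifiedAt (𝓞 ↥(maximalRealSubfield L)) W.1.asIdeal) →
    ∀ (K : Subgroup (HLoc L w)),
      K = (cmLocalIntegralLevel L 2 (Matrix.of fun i j : Fin 2 => if i.val + j.val + 1 = 2 then (1 : L) else 0) w).prod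
            (cmLocalIntegralLevel L 1 (Matrix.of fun i j : Fin 1 => if i.val + j.val + 1 = 1 then (1 : L) else 0) w) →
      ∀ {V : Type} [AddCommGroup V] [Module ℂ V] (π : Representation ℂ (HLoc L w) V) (hline : Module.finrank ℂ ↥(π.fixedPoints K) = 1),
        ∃ (χ₂ : ↥(torusU (conjLocal L (IsCMField.complexConj L) w) (cmLocalForm L 2 w)) →* ℂˣ) (χ₁ : H1Loc L w →* ℂˣ),
          IsOpen ((χ₁.ker : Subgroup (H1Loc L w)) : Set (H1Loc L w)) ∧
            ∃ hlineP : Module.finrank ℂ ↥((cmPrincipalSeriesH L w χ₂ χ₁).fixedPoints K) = 1,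
              unopSphericalCharacter K (cmPrincipalSeriesH L w χ₂ χ₁) hlineP = unopSphericalCharacter K π hline

/-- Read-back of `SatakeParameterOfRhoLetter` (definitional). [cite: CartierCorvallis1979, §IV.1 Cor. 4.2] -/
theorem satakeParameterOfRhoLetter_iff (L : Type) [Field L] [NumberField L] [IsCMField L] (w : Pl L) :
    SatakeParameterOfRhoLetter L w ↔
      ((∀ W : PlacesOver L w, Algebra.IsUnramifiedAt (𝓞 ↥(maximalRealSubfield L)) W.1.asIdeal) →
        ∀ (K : Subgroup (HLoc L w)),
          K = (cmLocalIntegralLevel L 2 (Matrix.of fun i j : Fin 2 => if i.val + j.val + 1 = 2 then (1 : L) else 0) w).prod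
                (cmLocalIntegralLevel L 1 (Matrix.of fun i j : Fin 1 => if i.val + j.val + 1 = 1 then (1 : L) else 0) w) →
          ∀ {V : Type} [AddCommGroup V] [Module ℂ V] (π : Representation ℂ (HLoc L w) V) (hline : Module.finrank ℂ ↥(π.fixedPoints K) = 1),
            ∃ (χ₂ : ↥(torusU (conjLocal L (IsCMField.complexConj L) w) (cmLocalForm L 2 w)) →* ℂˣ) (χ₁ : H1Loc L w →* ℂˣ),
              IsOpen ((χ₁.ker : Subgroup (H1Loc L w)) : Set (H1Loc L w)) ∧
                ∃ hlineP : Module.finrank ℂ ↥((cmPrincipalSeriesH L w χ₂ χ₁).fixedPoints K) = 1,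
                  unopSphericalCharacter K (cmPrincipalSeriesH L w χ₂ χ₁) hlineP = unopSphericalCharacter K π hline) :=
  Iff.rfl

/-! ## §2 The bridge to ★ p865188's `hSat` binder at the frozen datum -/

section Frozen

variable {L : Type} [Field L] [NumberField L] [IsCMField L] [DecidableEq (Pl L)] {μ : HeckeCharacter L} {v : Pl L}
  [MeasurableSpace (HLoc L v)] [BorelSpace (HLoc L v)] [MeasurableSpace (Gqs L v)] [BorelSpace (Gqs L v)]
  {νHv : Measure (HLoc L v)} {νQv : Measure (Gqs L v)} [νHv.IsHaarMeasure] [νHv.IsMulRightInvariant] [νQv.IsHaarMeasure] [νQv.IsMulRightInvariant]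
  [∀ a : HLoc L v, MeasurableSpace (HLoc L v ⧸ Subgroup.centralizer ({a} : Set (HLoc L v)))]
  [∀ a : HLoc L v, BorelSpace (HLoc L v ⧸ Subgroup.centralizer ({a} : Set (HLoc L v)))]
  [∀ γ : Gqs L v, MeasurableSpace (Gqs L v ⧸ Subgroup.centralizer ({γ} : Set (Gqs L v)))]
  [∀ γ : Gqs L v, BorelSpace (Gqs L v ⧸ Subgroup.centralizer ({γ} : Set (Gqs L v)))]
  {mHv : OrbitalMeasureFamily (HLoc L v)} {mQv : OrbitalMeasureFamily (Gqs L v)} {πSt : IrrClass (HLoc L v)}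
  [MeasurableSpace (H2 L).Adelic] [BorelSpace (H2 L).Adelic]
  [MeasurableSpace (GArch L)] [BorelSpace (GArch L)] [MeasurableSpace (HArch L)] [BorelSpace (HArch L)]
  [MeasurableSpace (H1Loc L v)] [MeasurableSpace (H1Arch L)] [MeasurableSpace (H1 L).Adelic] [BorelSpace (H1 L).Adelic]

set_option maxHeartbeats 800000 in -- the statement carries ★ p865188's `hSat` binder (two `cmPrincipalSeriesH` fixed-point types); as there (:135), default 200000 is exhausted at `whnf`∕`isDefEq`
/-- **THE BRIDGE: `SatakeParameterOfRhoLetter L w` ⇒ ★ p865188's `hSat` at the frozen datum `𝔥` and `w ≠ v`.**  Off `v` the datum's level is standard (`K_{H,w} = K_{2,w} × K_{1,w} =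
U(Φ₂)(𝒪_w) × U(Φ₁)(𝒪_w)`, ★ fields `hKH`, `hK₂std`, `hK₁std`), so the letter at `π := ρ_w` is the binder VERBATIM. [cite: Rogawski1990, §13.8 p. 218 L9, p. 219 L2–L3]
[cite: CartierCorvallis1979, §IV.1 Cor. 4.2] -/
theorem S10HDatum.hSat_of_satakeParameterOfRhoLetter (𝔥 : S10HDatum L μ v νHv νQv mHv mQv πSt) {w : Pl L} (hw : w ≠ v)
    (hU : ∀ W : PlacesOver L w, Algebra.IsUnramifiedAt (𝓞 ↥(maximalRealSubfield L)) W.1.asIdeal) (h : SatakeParameterOfRhoLetter L w)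
    (hline1 : letI := 𝔥.acV w
      letI := 𝔥.mdV w
      Module.finrank ℂ ↥((𝔥.ρ w).fixedPoints (𝔥.KH w)) = 1) :
    letI := 𝔥.acV w
    letI := 𝔥.mdV w
    ∃ (χ₂ : ↥(torusU (conjLocal L (IsCMField.complexConj L) w) (cmLocalForm L 2 w)) →* ℂˣ) (χ₁ : H1Loc L w →* ℂˣ),
      IsOpen ((χ₁.ker : Subgroup (H1Loc L w)) : Set (H1Loc L w)) ∧
        ∃ hlineP : Module.finrank ℂ ↥((cmPrincipalSeriesH L w χ₂ χ₁).fixedPoints (𝔥.KH w)) = 1,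
          unopSphericalCharacter (𝔥.KH w) (cmPrincipalSeriesH L w χ₂ χ₁) hlineP = unopSphericalCharacter (𝔥.KH w) (𝔥.ρ w) hline1 := by
  letI := 𝔥.acV w
  letI := 𝔥.mdV w
  have hK : 𝔥.KH w =
      (cmLocalIntegralLevel L 2 (Matrix.of fun i j : Fin 2 => if i.val + j.val + 1 = 2 then (1 : L) else 0) w).prod
        (cmLocalIntegralLevel L 1 (Matrix.of fun i j : Fin 1 => if i.val + j.val + 1 = 1 then (1 : L) else 0) w) := by
    rw [𝔥.hKH w, 𝔥.hK₂std w hw, 𝔥.hK₁std w hw]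
  exact h hU (𝔥.KH w) hK (𝔥.ρ w) hline1

end Frozen

end Summit.HodgeConjecture.HodgeConjecture.R90.S10

end
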